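import Literature.Algebra.EuclideanLattices.LatticeThetaSeries
import Literature.Algebra.EuclideanLattices.IntegerLatticeTheta
import Mathlib.NumberTheory.ModularForms.LevelOne.Basic
import HarnessLib

/-!
# Elkies' theorem, analytic part: `Θ_Γ = θ₃ⁿ` when all characteristic vectors are long

Topic `Literature/Algebra/EuclideanLattices`. The modular-function argument of N. D. Elkies,
*A characterization of the `ℤⁿ` lattice*, Math. Res. Lett. 2 (1995) 321–326: if `Γ ⊂ ℝⁿ` is an
integral self-dual (= unimodular) lattice with a characteristic vector `w` all of whose translates
`w + 2Γ` (the characteristic vectors of `Γ`) have square length `≥ n`, then the theta series of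
`Γ` equals that of `ℤⁿ`: `Θ_Γ(τ) = Θ_{ℤⁿ}(τ) = θ₃(τ)ⁿ` for `Im τ > 0`
(`tsum_cexp_eq_tsum_cexp_span_basisFun`, `tsum_cexp_eq_theta3_pow`). Everything here is proved;
no definition and no named fact is introduced.

**Elkies' argument** (loc. cit., proof of the Theorem), in the form formalised here. Put
`f = Θ_Γ/Θ_{ℤⁿ}`, a holomorphic function on the upper half plane `ℍ` (`Θ_{ℤⁿ} = θ₃ⁿ` has no
zeros). Both theta series have period `2` and satisfy the same inversion formula
`Θ(τ) = (i/τ)^{n/2} Θ(-1/τ)` (Poisson summation for a self-dual lattice,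
`LatticeThetaSeries.lean`), so `f(τ + 2) = f(τ) = f(-1/τ)`. With the shifted inversion formula
and the characteristic property `⟨w, y⟩ ≡ ‖y‖² (mod 2)` one finds
`Θ_{Γ+w/2}(τ) = (i/τ)^{n/2} Θ_Γ(1 - 1/τ)`
and likewise for `ℤⁿ` with `𝟙 = (1, …, 1)`, so `f(1 - 1/τ) = Θ_{Γ+w/2}(τ)/Θ_{ℤⁿ+𝟙/2}(τ) =
Θ_{Γ+w/2}(τ)/θ₂(τ)ⁿ`. Hence the three functions `g₁ = f`, `g₂ = f(· + 1)`, `g₃ = f(1 - 1/·)` on `ℍ`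
are permuted by `τ ↦ τ + 1` (as `(g₂, g₁, g₃)`) and by `τ ↦ -1/τ` (as `(g₁, g₃, g₂)`), and
`P = (g₁ - 1)(g₂ - 1)(g₃ - 1)` is an `SL₂(ℤ)`-invariant holomorphic function on `ℍ`. At `i∞`,
`g₁, g₂ → 1`, while `|Θ_{Γ+w/2}(τ)| ≤ C e^{-π Im τ · n/4}` (all `‖x + w/2‖² ≥ n/4`) and
`|θ₂(τ)| ∼ 2 e^{-π Im τ/4}` keep `g₃` bounded; so `P` is a modular form of weight `0` and level `1`
tending to `0` at the cusp, hence `P = 0` (Mathlib's `ModularFormClass.levelOne_weight_zero_const`).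
By the identity theorem one of the three factors vanishes identically, and each case gives
`f = 1`. (Elkies phrases the last step through the cusps of `Γ₊ = ⟨τ ↦ τ+2, τ ↦ -1/τ⟩`; the
symmetric product `P` replaces that bookkeeping by level one.)

The lattice-theoretic conclusion (`Γ ≅ ℤⁿ`, i.e. Elkies' theorem proper, and its form for
`LinearMap.BilinForm ℤ M`) is drawn in `ElkiesTheorem.lean`.

## References

* N. D. Elkies, *A characterization of the `ℤⁿ` lattice*, Math. Res. Lett. 2 (1995) 321–326,
  Theorem and its proof. [Elkies1995]
* J. H. Conway, N. J. A. Sloane, *Sphere Packings, Lattices and Groups*, 3rd ed. (1999), Ch. 4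
  §4.1 (14)–(22), Ch. 7 §7 (theta series of unimodular lattices as modular forms).
  [ConwaySloane1999]
-/

noncomputable section

open Complex Filter Topology Module Submodule
open UpperHalfPlane hiding I
open scoped Real RealInnerProductSpace MatrixGroups ModularForm Manifold

namespace Literature.Algebra.EuclideanLattices

/-! ### Helpers -/

/-- `(i/τ)^s ≠ 0` for `τ ≠ 0`. [folklore] -/
theorem I_div_cpow_ne_zero {τ : ℂ} (hτ : τ ≠ 0) (s : ℂ) : (I / τ) ^ s ≠ 0 := by
  rw [Ne, cpow_eq_zero_iff, not_and_or]
  exact Or.inl (div_ne_zero I_ne_zero hτ)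

/-- `Im(τ + 1) = Im τ`. [folklore] -/
theorem add_one_im (τ : ℂ) : (τ + 1).im = τ.im := by simp

/-- `Im(1 - 1/τ) > 0` for `Im τ > 0`. [folklore] -/
theorem one_sub_inv_im_pos {τ : ℂ} (hτ : 0 < τ.im) : 0 < (1 - τ⁻¹).im := by
  have := neg_inv_im_pos hτ
  rw [sub_eq_add_neg, add_im, one_im, zero_add]
  rwa [neg_im] at this ⊢

/-- `Im(τ/(τ+1)) > 0` for `Im τ > 0`. [folklore] -/
theorem div_add_one_im_pos {τ : ℂ} (hτ : 0 < τ.im) : 0 < (τ / (τ + 1)).im := by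
  have h1 : τ + 1 ≠ 0 := fun h => by
    have := congrArg Complex.im h; simp at this; linarith
  rw [div_eq_mul_inv, mul_im, inv_re, inv_im]
  have hns : 0 < normSq (τ + 1) := normSq_pos.mpr h1
  simp only [add_re, one_re, add_im, one_im, add_zero]
  rw [show τ.re * (-τ.im / normSq (τ + 1)) + τ.im * ((τ.re + 1) / normSq (τ + 1)) =
    τ.im / normSq (τ + 1) by field_simp; ring]
  positivity

/-- The Möbius bookkeeping `-1/(τ/(τ+1)) = -1 - 1/τ`. [folklore] -/
theorem neg_inv_div_add_one {τ : ℂ} (hτ : τ ≠ 0) : -(τ / (τ + 1))⁻¹ = -1 - τ⁻¹ := by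
  field_simp
  ring

/-- Sums over equal sublattices agree. [folklore] -/
theorem tsum_subtype_eq_of_eq {V : Type*} [AddCommGroup V] [Module ℝ V] {L₁ L₂ : Submodule ℤ V}
    (h : L₁ = L₂) (F : V → ℂ) : ∑' x : L₁, F x = ∑' x : L₂, F x := by
  subst h
  rfl

/-- **Analytic functions on a connected open set form an integral domain**: if `g h = 0` on a
preconnected open `U ⊆ ℂ` for `g`, `h` analytic on `U`, then `g = 0` on `U` or `h = 0` on `U`
(identity theorem). [folklore] -/
theorem eqOn_zero_or_eqOn_zero_of_mul {U : Set ℂ} (hU : IsOpen U) (hU' : IsPreconnected U)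
    {g h : ℂ → ℂ} (hg : DifferentiableOn ℂ g U) (hh : DifferentiableOn ℂ h U)
    (hgh : ∀ z ∈ U, g z * h z = 0) : Set.EqOn g 0 U ∨ Set.EqOn h 0 U := by
  by_cases hg0 : Set.EqOn g 0 U
  · exact Or.inl hg0
  · right
    obtain ⟨z₀, hz₀, hgz₀⟩ : ∃ z₀ ∈ U, g z₀ ≠ 0 := by
      by_contra hcon
      push Not at hcon
      exact hg0 fun z hz => hcon z hz
    have hga : AnalyticOnNhd ℂ h U := hh.analyticOnNhd hU
    refine hga.eqOn_zero_of_preconnected_of_eventuallyEq_zero hU' hz₀ ?_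
    -- `g ≠ 0` near `z₀`, so `h = 0` near `z₀`
    have hcont : ContinuousAt g z₀ := (hg.continuousOn.continuousWithinAt hz₀).continuousAt
      (hU.mem_nhds hz₀)
    have hne : ∀ᶠ z in 𝓝 z₀, g z ≠ 0 := hcont.eventually_ne hgz₀
    filter_upwards [hne, hU.mem_nhds hz₀] with z hz hzU
    have := hgh z hzU
    rcases mul_eq_zero.mp this with h0 | h0
    · exact absurd h0 hz
    · exact h0

/-- **A level-one modular function without pole or constant term at the cusp vanishes**: a
function `P : ℍ → ℂ` invariant under `S` and `T` in weight `0`, holomorphic on `ℍ` and tending to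
`0` at `i∞` is identically `0` (it is a modular form of weight `0` for `SL₂(ℤ)`, hence constant by
Mathlib's `ModularFormClass.levelOne_weight_zero_const`, and the constant is its limit at `i∞`).
[folklore] -/
theorem eq_zero_of_slash_invariant_of_tendsto_zero {P : ℍ → ℂ}
    (hS : P ∣[(0 : ℤ)] ModularGroup.S = P) (hT : P ∣[(0 : ℤ)] ModularGroup.T = P)
    (hmd : MDiff P) (hlim : Tendsto P atImInfty (𝓝 0)) (z : ℍ) : P z = 0 := by
  have hSL : ∀ γ : SL(2, ℤ), P ∣[(0 : ℤ)] γ = P :=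
    SlashInvariantForm.slash_action_generators_SL2Z hS hT
  have hPbdd : IsBoundedAtImInfty P := by
    rw [isBoundedAtImInfty_iff]
    obtain ⟨A, hA⟩ : ∃ A : ℝ, ∀ z : ℍ, A ≤ z.im → ‖P z‖ ≤ 1 := by
      have h := (tendsto_norm.comp hlim).eventually (Iic_mem_nhds (by norm_num : ‖(0 : ℂ)‖ < 1))
      rw [Filter.Eventually, atImInfty_mem] at h
      exact h
    exact ⟨1, A, hA⟩
  let Pf : ModularForm 𝒮ℒ 0 :=
    { toFun := P
      slash_action_eq' := fun A hA => by
        obtain ⟨γ, rfl⟩ := hA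
        exact hSL γ
      holo' := hmd
      bdd_at_cusps' := fun hc => by
        rw [Subgroup.IsArithmetic.isCusp_iff_isCusp_SL2Z] at hc
        rw [OnePoint.isBoundedAt_iff_forall_SL2Z hc]
        intro γ _
        rw [hSL γ]
        exact hPbdd }
  obtain ⟨c, hc⟩ := ModularFormClass.levelOne_weight_zero_const Pf
  have hPc : ∀ z : ℍ, P z = c := fun z => congrFun hc z
  have hc0 : c = 0 :=
    tendsto_nhds_unique tendsto_const_nhds (hlim.congr hPc)
  rw [hPc, hc0]

/-! ### Inversion formulas for a self-dual lattice -/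

section SelfDual

variable {V : Type*} [NormedAddCommGroup V] [InnerProductSpace ℝ V] [FiniteDimensional ℝ V]
  [MeasurableSpace V] [BorelSpace V] (Γ : Submodule ℤ V) [DiscreteTopology Γ] [IsZLattice ℝ Γ]

/-- **Theta inversion for a self-dual lattice**: `Θ_Γ(τ) = (i/τ)^{n/2} Θ_Γ(-1/τ)` when `Γ* = Γ`
(then `vol(V/Γ) = 1`; Conway–Sloane Ch. 4 §4.1 (19) with `det Λ = 1`; Elkies 1995: "since `L` is its
own dual lattice we obtain by Poisson inversion `(t/i)^{n/2} θ_L(t) = θ_L(-1/t) = θ_L(S(t))`").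
[cite: Elkies1995, functional equation (θS) before the Theorem] -/
theorem tsum_cexp_eq_cpow_mul_tsum_neg_inv (hdual : dualLattice Γ = Γ) {τ : ℂ} (hτ : 0 < τ.im) :
    ∑' x : Γ, cexp ((π : ℂ) * I * τ * ((‖(x : V)‖ ^ 2 : ℝ) : ℂ)) =
      (I / τ) ^ ((finrank ℝ V : ℂ) / 2) *
        ∑' x : Γ, cexp ((π : ℂ) * I * (-τ⁻¹) * ((‖(x : V)‖ ^ 2 : ℝ) : ℂ)) := by
  rw [tsum_cexp_pi_I_mul_norm_sq_eq Γ hτ, covolume_eq_one_of_dualLattice_eq Γ hdual, inv_one,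
    one_smul,
    tsum_subtype_eq_of_eq hdual fun y => cexp ((π : ℂ) * I * (-τ⁻¹) * ((‖y‖ ^ 2 : ℝ) : ℂ))]

/-- **Shifted theta inversion through a characteristic vector**: if `Γ* = Γ` and `w ∈ V`
satisfies `⟨w, y⟩ ≡ ‖y‖² (mod 2)` for all `y ∈ Γ`, then
`Θ_{Γ + w/2}(τ) = (i/τ)^{n/2} Θ_Γ(1 - 1/τ)` — the phases `e^{2πi⟨w/2, y⟩} = e^{πi‖y‖²}` of the
Poisson sum turn into the shift `τ ↦ τ + 1` (Elkies 1995: "`θ_L(TS(t)) = θ_L(-1/t + 1) =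
(t/i)^{n/2} θ'_L(t)`, where `θ'_L(t) = ∑_{v ∈ L + w/2} e^{πi|v|²t}`" — the key formula (θTS),
also the "shadow" formula of Conway–Sloane).
[cite: Elkies1995, formula (θTS) before the Theorem] -/
theorem tsum_cexp_shift_eq_cpow_mul_tsum (hdual : dualLattice Γ = Γ) {w : V}
    (hchar : ∀ y : Γ, ∃ k : ℤ, ⟪w, (y : V)⟫ - ‖(y : V)‖ ^ 2 = 2 * k) {τ : ℂ} (hτ : 0 < τ.im) :
    ∑' x : Γ, cexp ((π : ℂ) * I * τ * ((‖(x : V) + (2⁻¹ : ℝ) • w‖ ^ 2 : ℝ) : ℂ)) =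
      (I / τ) ^ ((finrank ℝ V : ℂ) / 2) *
        ∑' x : Γ, cexp ((π : ℂ) * I * (1 - τ⁻¹) * ((‖(x : V)‖ ^ 2 : ℝ) : ℂ)) := by
  rw [tsum_cexp_pi_I_mul_norm_add_sq_eq Γ hτ, covolume_eq_one_of_dualLattice_eq Γ hdual, inv_one,
    one_smul, tsum_subtype_eq_of_eq hdual fun y => cexp (2 * π * I * (⟪(2⁻¹ : ℝ) • w, y⟫ : ℝ)) *
      cexp (-π * I * ((‖y‖ ^ 2 : ℝ) : ℂ) / τ)]
  congr 1
  refine tsum_congr fun y => ?_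
  obtain ⟨k, hk⟩ := hchar y
  have hinner : (⟪(2⁻¹ : ℝ) • w, (y : V)⟫ : ℝ) = 2⁻¹ * (‖(y : V)‖ ^ 2 + 2 * k) := by
    rw [real_inner_smul_left, ← hk]; ring
  rw [hinner, ← Complex.exp_add]
  have h2 : cexp (2 * π * I * (((2 : ℝ)⁻¹ * (‖(y : V)‖ ^ 2 + 2 * k) : ℝ) : ℂ) +
      -π * I * ((‖(y : V)‖ ^ 2 : ℝ) : ℂ) / τ) =
      cexp ((π : ℂ) * I * (1 - τ⁻¹) * ((‖(y : V)‖ ^ 2 : ℝ) : ℂ) + k * (2 * π * I)) := by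
    congr 1
    push_cast
    field_simp
    ring
  rw [h2, Complex.exp_add, Complex.exp_int_mul_two_pi_mul_I, mul_one]

end SelfDual

/-! ### The modular argument -/

section Main

variable {V : Type*} [NormedAddCommGroup V] [InnerProductSpace ℝ V] [FiniteDimensional ℝ V]
  [MeasurableSpace V] [BorelSpace V] (Γ : Submodule ℤ V) [DiscreteTopology Γ] [IsZLattice ℝ Γ]

/-- The vector `½𝟙` of `EuclideanSpace ℝ (Fin n)` written as a scalar multiple. [folklore] -/
theorem half_smul_ones (n : ℕ) :
    (2⁻¹ : ℝ) • (WithLp.toLp 2 fun _ : Fin n => ((1 : ℤ) : ℝ) : EuclideanSpace ℝ (Fin n)) =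
      WithLp.toLp 2 fun _ => (1 / 2 : ℝ) := by
  ext i
  simp

/-- `𝟙 = (1, …, 1)` is a characteristic vector of `ℤⁿ`: `⟨𝟙, y⟩ - ‖y‖² ∈ 2ℤ` on `Λₙ`. [folklore] -/
theorem ones_characteristic (n : ℕ)
    (y : span ℤ (Set.range (EuclideanSpace.basisFun (Fin n) ℝ).toBasis)) :
    ∃ k : ℤ, ⟪(WithLp.toLp 2 fun _ : Fin n => ((1 : ℤ) : ℝ) : EuclideanSpace ℝ (Fin n)),
      (y : EuclideanSpace ℝ (Fin n))⟫ - ‖(y : EuclideanSpace ℝ (Fin n))‖ ^ 2 = 2 * k := by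
  obtain ⟨m, hm⟩ :=
    ((EuclideanSpace.basisFun (Fin n) ℝ).toBasis.restrictScalars ℤ).equivFun.symm.surjective y
  have hy : (y : EuclideanSpace ℝ (Fin n)) = WithLp.toLp 2 fun i => (m i : ℝ) := by
    rw [← hm, coe_equivFun_symm_eq_toLp]
  obtain ⟨k, hk⟩ := even_sum_sub_sum_sq n m
  refine ⟨k, ?_⟩
  rw [hy, inner_toLp_intCast, norm_toLp_intCast_sq]
  exact_mod_cast (show (∑ i, 1 * m i - ∑ i, m i ^ 2 : ℤ) = 2 * k by rw [hk]; ring)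

/-- The characteristic vectors `𝟙 + 2ℤⁿ` are not needed; only periodicity of `Θ_{ℤⁿ}`: every
vector of `Λₙ` has integral square length (restated with the coercion used below). [folklore] -/
theorem exists_norm_sq_eq_intCast_span_basisFun (n : ℕ)
    (x : span ℤ (Set.range (EuclideanSpace.basisFun (Fin n) ℝ).toBasis)) :
    ∃ k : ℤ, ‖(x : EuclideanSpace ℝ (Fin n))‖ ^ 2 = k :=
  exists_norm_sq_eq_intCast_of_mem n x

/-- **Elkies' theorem, analytic form** (Elkies 1995, Theorem: "Let `L` be a unimodular integral
lattice in `ℝⁿ` with no characteristic vector `w` such that `|w|² < n`. Then `L ≅ ℤⁿ`", whose proof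
first shows "that `L` and `ℤⁿ` have the same theta function" via `R(t) = θ_L(t)/θ_ℤ(t)ⁿ`; this is
that identity). Let `Γ` be a full lattice in the Euclidean space `V`, `dim V = n`,
which is integral (`‖x‖² ∈ ℤ` on `Γ`) and self-dual (`Γ* = Γ`), and let `w ∈ V` satisfy
`⟨w, x⟩ ≡ ‖x‖² (mod 2)` and `‖2x + w‖² ≥ n` for all `x ∈ Γ` (i.e. `w` is a characteristic vector of
`Γ` and all characteristic vectors `w + 2Γ` have square length `≥ n`). Then
`Θ_Γ(τ) = Θ_{ℤⁿ}(τ)` for `Im τ > 0`. See the module docstring for the proof (the modular function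
`Θ_Γ/θ₃ⁿ` for `Γ₊ = ⟨τ ↦ τ + 2, τ ↦ -1/τ⟩` is bounded at both cusps, hence constant).
[cite: Elkies1995, Theorem and proof] -/
theorem tsum_cexp_eq_tsum_cexp_span_basisFun (hint : ∀ x : Γ, ∃ k : ℤ, ‖(x : V)‖ ^ 2 = k)
    (hdual : dualLattice Γ = Γ) {w : V}
    (hchar : ∀ x : Γ, ∃ k : ℤ, ⟪w, (x : V)⟫ - ‖(x : V)‖ ^ 2 = 2 * k)
    (hmin : ∀ x : Γ, (finrank ℝ V : ℝ) ≤ ‖(2 : ℝ) • (x : V) + w‖ ^ 2) {τ : ℂ} (hτ : 0 < τ.im) :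
    ∑' x : Γ, cexp ((π : ℂ) * I * τ * ((‖(x : V)‖ ^ 2 : ℝ) : ℂ)) =
      ∑' x : span ℤ (Set.range (EuclideanSpace.basisFun (Fin (finrank ℝ V)) ℝ).toBasis),
        cexp ((π : ℂ) * I * τ * ((‖(x : EuclideanSpace ℝ (Fin (finrank ℝ V)))‖ ^ 2 : ℝ) : ℂ)) := by
  classical
  -- ### notation (local to the proof)
  set n : ℕ := finrank ℝ V with hn
  set Λ : Submodule ℤ (EuclideanSpace ℝ (Fin n)) :=
    span ℤ (Set.range (EuclideanSpace.basisFun (Fin n) ℝ).toBasis) with hΛ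
  set e1 : EuclideanSpace ℝ (Fin n) := WithLp.toLp 2 fun _ : Fin n => ((1 : ℤ) : ℝ) with he1
  set θ : ℂ → ℂ := fun σ => ∑' x : Γ, cexp ((π : ℂ) * I * σ * ((‖(x : V)‖ ^ 2 : ℝ) : ℂ)) with hθ
  set θw : ℂ → ℂ := fun σ =>
    ∑' x : Γ, cexp ((π : ℂ) * I * σ * ((‖(x : V) + (2⁻¹ : ℝ) • w‖ ^ 2 : ℝ) : ℂ)) with hθw
  set ϑ : ℂ → ℂ := fun σ =>
    ∑' x : Λ, cexp ((π : ℂ) * I * σ * ((‖(x : EuclideanSpace ℝ (Fin n))‖ ^ 2 : ℝ) : ℂ)) with hϑ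
  set ϑw : ℂ → ℂ := fun σ => ∑' x : Λ,
    cexp ((π : ℂ) * I * σ * ((‖(x : EuclideanSpace ℝ (Fin n)) + (2⁻¹ : ℝ) • e1‖ ^ 2 : ℝ) : ℂ))
    with hϑw
  have hnE : finrank ℝ (EuclideanSpace ℝ (Fin n)) = n := finrank_euclideanSpace_fin
  -- the set `U = {Im > 0}`
  set U : Set ℂ := {σ : ℂ | 0 < σ.im} with hU
  have hUo : IsOpen U := isOpen_lt continuous_const Complex.continuous_im
  have hUc : IsPreconnected U := (convex_halfSpace_im_gt 0).isPreconnected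
  -- ### nonvanishing of the `ℤⁿ` theta series
  have hϑ0 : ∀ σ : ℂ, 0 < σ.im → ϑ σ ≠ 0 := fun σ hσ => tsum_cexp_span_basisFun_ne_zero n hσ
  have hϑw_eq : ∀ σ : ℂ, 0 < σ.im →
      ϑw σ = Literature.NumberTheory.EllipticCurves.JacobiThetaNull.theta2 σ ^ n := fun σ hσ => by
    simp only [hϑw, he1, half_smul_ones]
    exact tsum_cexp_span_basisFun_half_eq_theta2_pow n hσ
  have hϑw0 : ∀ σ : ℂ, 0 < σ.im → ϑw σ ≠ 0 := fun σ hσ => by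
    rw [hϑw_eq σ hσ]
    exact pow_ne_zero _ (Literature.NumberTheory.Automorphic.ModularLambda.theta2_ne_zero hσ)
  -- ### periodicity and inversion
  have hθ2 : ∀ σ : ℂ, θ (σ + 2) = θ σ := fun σ => tsum_cexp_pi_I_mul_norm_sq_add_two Γ hint σ
  have hϑ2 : ∀ σ : ℂ, ϑ (σ + 2) = ϑ σ := fun σ =>
    tsum_cexp_pi_I_mul_norm_sq_add_two Λ (exists_norm_sq_eq_intCast_span_basisFun n) σ
  have hΛdual : dualLattice Λ = Λ := dualLattice_span_basisFun n
  have hθS : ∀ σ : ℂ, 0 < σ.im → θ σ = (I / σ) ^ ((n : ℂ) / 2) * θ (-σ⁻¹) := fun σ hσ =>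
    tsum_cexp_eq_cpow_mul_tsum_neg_inv Γ hdual hσ
  have hϑS : ∀ σ : ℂ, 0 < σ.im → ϑ σ = (I / σ) ^ ((n : ℂ) / 2) * ϑ (-σ⁻¹) := fun σ hσ => by
    have := tsum_cexp_eq_cpow_mul_tsum_neg_inv Λ hΛdual hσ
    rwa [hnE] at this
  have hθwS : ∀ σ : ℂ, 0 < σ.im → θw σ = (I / σ) ^ ((n : ℂ) / 2) * θ (1 - σ⁻¹) := fun σ hσ =>
    tsum_cexp_shift_eq_cpow_mul_tsum Γ hdual hchar hσ
  have hϑwS : ∀ σ : ℂ, 0 < σ.im → ϑw σ = (I / σ) ^ ((n : ℂ) / 2) * ϑ (1 - σ⁻¹) := fun σ hσ => by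
    have := tsum_cexp_shift_eq_cpow_mul_tsum Λ hΛdual (ones_characteristic n) hσ
    rwa [hnE] at this
  -- ### the ratio `f = θ/ϑ` and its symmetries
  set f : ℂ → ℂ := fun σ => θ σ / ϑ σ with hf
  have hf2 : ∀ σ : ℂ, f (σ + 2) = f σ := fun σ => by simp only [hf, hθ2, hϑ2]
  have hfS : ∀ σ : ℂ, 0 < σ.im → f (-σ⁻¹) = f σ := fun σ hσ => by
    have hσ0 : σ ≠ 0 := fun h => by rw [h, zero_im] at hσ; exact lt_irrefl _ hσ
    have hc := I_div_cpow_ne_zero hσ0 ((n : ℂ) / 2)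
    simp only [hf]
    rw [hθS σ hσ, hϑS σ hσ, mul_div_mul_left _ _ hc]
  have hfw : ∀ σ : ℂ, 0 < σ.im → θw σ / ϑw σ = f (1 - σ⁻¹) := fun σ hσ => by
    have hσ0 : σ ≠ 0 := fun h => by rw [h, zero_im] at hσ; exact lt_irrefl _ hσ
    have hc := I_div_cpow_ne_zero hσ0 ((n : ℂ) / 2)
    simp only [hf]
    rw [hθwS σ hσ, hϑwS σ hσ, mul_div_mul_left _ _ hc]
  -- `f(1 - 1/(σ+1)) = f(1 - 1/σ)` (through `-1/(σ/(σ+1)) = -1 - 1/σ` and the period `2`)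
  have hf3 : ∀ σ : ℂ, 0 < σ.im → f (1 - (σ + 1)⁻¹) = f (1 - σ⁻¹) := fun σ hσ => by
    have hσ0 : σ ≠ 0 := fun h => by rw [h, zero_im] at hσ; exact lt_irrefl _ hσ
    have hσ1 : σ + 1 ≠ 0 := fun h => by
      have := congrArg Complex.im h; simp at this; linarith
    have h1 : 1 - (σ + 1)⁻¹ = σ / (σ + 1) := by field_simp; ring
    rw [h1, ← hfS _ (div_add_one_im_pos hσ), neg_inv_div_add_one hσ0,
      show (1 : ℂ) - σ⁻¹ = (-1 - σ⁻¹) + 2 by ring, hf2]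
  -- ### differentiability on `U`
  have hθd : DifferentiableOn ℂ θ U := by
    have h := differentiableOn_tsum_cexp_pi_I_mul_norm_add_sq Γ (0 : V)
    simp only [add_zero] at h
    exact h
  have hϑd : DifferentiableOn ℂ ϑ U := by
    have h := differentiableOn_tsum_cexp_pi_I_mul_norm_add_sq Λ (0 : EuclideanSpace ℝ (Fin n))
    simp only [add_zero] at h
    exact h
  have hθwd : DifferentiableOn ℂ θw U :=
    differentiableOn_tsum_cexp_pi_I_mul_norm_add_sq Γ ((2⁻¹ : ℝ) • w)
  have hϑwd : DifferentiableOn ℂ ϑw U :=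
    differentiableOn_tsum_cexp_pi_I_mul_norm_add_sq Λ ((2⁻¹ : ℝ) • e1)
  have hfd : DifferentiableOn ℂ f U := hθd.div hϑd fun σ hσ => hϑ0 σ hσ
  have hmaps1 : Set.MapsTo (fun σ : ℂ => σ + 1) U U := fun σ hσ => by
    show 0 < (σ + 1).im; rw [add_one_im]; exact hσ
  have hf1d : DifferentiableOn ℂ (fun σ => f (σ + 1)) U :=
    hfd.comp ((differentiable_id.add_const 1).differentiableOn) hmaps1
  have hgd : DifferentiableOn ℂ (fun σ => θw σ / ϑw σ) U := hθwd.div hϑwd fun σ hσ => hϑw0 σ hσ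
  -- ### the three factors and the product, on `ℂ` and on `ℍ`
  set G₁ : ℂ → ℂ := fun σ => f σ - 1 with hG₁
  set G₂ : ℂ → ℂ := fun σ => f (σ + 1) - 1 with hG₂
  set G₃ : ℂ → ℂ := fun σ => θw σ / ϑw σ - 1 with hG₃
  have hG₁d : DifferentiableOn ℂ G₁ U := hfd.sub_const 1
  have hG₂d : DifferentiableOn ℂ G₂ U := hf1d.sub_const 1
  have hG₃d : DifferentiableOn ℂ G₃ U := hgd.sub_const 1
  set Pc : ℂ → ℂ := fun σ => G₁ σ * G₂ σ * G₃ σ with hPc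
  have hPcd : DifferentiableOn ℂ Pc U := (hG₁d.mul hG₂d).mul hG₃d
  set P : ℍ → ℂ := fun z => Pc z with hP
  -- values of the factors at `T • z` and `S • z`
  have hG₃' : ∀ σ : ℂ, 0 < σ.im → G₃ σ = f (1 - σ⁻¹) - 1 := fun σ hσ => by
    simp only [hG₃, hfw σ hσ]
  have hPT : ∀ z : ℍ, Pc ((z : ℂ) + 1) = Pc z := fun z => by
    have hz := z.im_pos
    have hz1 : 0 < ((z : ℂ) + 1).im := by rw [add_one_im]; exact hz
    simp only [hPc, hG₁, hG₂]
    rw [hG₃' _ hz1, hG₃' _ hz, hf3 _ hz, show (z : ℂ) + 1 + 1 = z + 2 by ring, hf2]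
    ring
  have hPS : ∀ z : ℍ, Pc (-(z : ℂ)⁻¹) = Pc z := fun z => by
    have hz := z.im_pos
    have hz' : 0 < (-(z : ℂ)⁻¹).im := neg_inv_im_pos hz
    simp only [hPc, hG₁, hG₂]
    rw [hG₃' _ hz', hG₃' _ hz, hfS _ hz, inv_neg, inv_inv, sub_neg_eq_add,
      show -(z : ℂ)⁻¹ + 1 = 1 - (z : ℂ)⁻¹ by ring, show (1 : ℂ) + z = z + 1 by ring]
    ring
  -- ### invariance under `SL₂(ℤ)` (weight `0`)
  have hT : P ∣[(0 : ℤ)] ModularGroup.T = P := by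
    funext z
    rw [ModularForm.SL_slash_apply, neg_zero, zpow_zero, mul_one, modular_T_smul]
    simp only [hP]
    rw [coe_vadd, ofReal_one, add_comm]
    exact hPT z
  have hS : P ∣[(0 : ℤ)] ModularGroup.S = P := by
    funext z
    rw [ModularForm.SL_slash_apply, neg_zero, zpow_zero, mul_one, modular_S_smul]
    simp only [hP]
    rw [coe_mk, inv_neg]
    exact hPS z
  have hSL : ∀ γ : SL(2, ℤ), P ∣[(0 : ℤ)] γ = P :=
    SlashInvariantForm.slash_action_generators_SL2Z hS hT
  -- ### holomorphy on `ℍ`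
  have hPmd : MDiff P := by
    rw [UpperHalfPlane.mdifferentiable_iff]
    refine hPcd.congr fun σ hσ => ?_
    simp only [Function.comp_apply, hP]
    rw [ofComplex_apply_of_im_pos hσ]
  -- ### behaviour at `i∞`
  -- `θ → 1`, `ϑ → 1`, hence `f → 1` along `Im → ∞`
  have hθlim : Tendsto θ (comap Complex.im atTop) (𝓝 1) := by
    have h := tendsto_tsum_cexp_pi_I_mul_norm_sq Γ
    exact h
  have hϑlim : Tendsto ϑ (comap Complex.im atTop) (𝓝 1) := tendsto_tsum_cexp_pi_I_mul_norm_sq Λ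
  have hflim : Tendsto f (comap Complex.im atTop) (𝓝 1) := by
    have := hθlim.div hϑlim one_ne_zero
    rwa [div_one] at this
  have hadd1 : Tendsto (fun σ : ℂ => σ + 1) (comap Complex.im atTop) (comap Complex.im atTop) := by
    refine tendsto_comap_iff.mpr ?_
    have : Complex.im ∘ (fun σ : ℂ => σ + 1) = Complex.im := funext fun σ => add_one_im σ
    rw [this]
    exact tendsto_comap
  have hG₁lim : Tendsto (fun z : ℍ => G₁ z) atImInfty (𝓝 0) := by
    have := (hflim.comp tendsto_coe_atImInfty).sub_const 1
    rw [sub_self] at this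
    exact this
  have hG₂lim : Tendsto (fun z : ℍ => G₂ z) atImInfty (𝓝 0) := by
    have := ((hflim.comp hadd1).comp tendsto_coe_atImInfty).sub_const 1
    rw [sub_self] at this
    exact this
  -- `G₃` is bounded: `|θw| ≤ C₀ e^{-π (Im - 1) n/4}`, `|ϑw| = |θ₂|ⁿ ≥ e^{-π Im · n/4}` eventually
  have hmin' : ∀ x : Γ, (n : ℝ) / 4 ≤ ‖(x : V) + (2⁻¹ : ℝ) • w‖ ^ 2 := fun x => by
    have h := hmin x
    have h2 : (2 : ℝ) • (x : V) + w = (2 : ℝ) • ((x : V) + (2⁻¹ : ℝ) • w) := by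
      rw [smul_add, smul_smul]; norm_num
    rw [h2, norm_smul, mul_pow, Real.norm_eq_abs, abs_of_pos two_pos] at h
    linarith
  set C₀ : ℝ := ∑' x : Γ, Real.exp (-π * ‖(x : V) + (2⁻¹ : ℝ) • w‖ ^ 2) with hC₀
  have hC₀nn : 0 ≤ C₀ := tsum_nonneg fun x => (Real.exp_pos _).le
  have hθwbd : ∀ σ : ℂ, 1 ≤ σ.im →
      ‖θw σ‖ ≤ Real.exp (-π * (σ.im - 1) * ((n : ℝ) / 4)) * C₀ := fun σ hσ =>
    norm_tsum_cexp_pi_I_mul_norm_add_sq_le Γ hσ ((2⁻¹ : ℝ) • w) hmin'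
  -- lower bound for `θ₂` from `e^{-πiσ/4} θ₂(σ) → 2`
  obtain ⟨A₀, hA₀⟩ : ∃ A₀ : ℝ, ∀ σ : ℂ, A₀ ≤ σ.im →
      Real.exp (-π * σ.im / 4) ≤
        ‖Literature.NumberTheory.EllipticCurves.JacobiThetaNull.theta2 σ‖ := by
    have h := Literature.NumberTheory.EllipticCurves.JacobiThetaNull.tendsto_theta2
    have h1 : ∀ᶠ σ : ℂ in comap Complex.im atTop,
        1 < ‖cexp (-(π * I * σ / 4)) *
          Literature.NumberTheory.EllipticCurves.JacobiThetaNull.theta2 σ‖ := by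
      have := (tendsto_norm.comp h).eventually (lt_mem_nhds (by norm_num : (1 : ℝ) < ‖(2 : ℂ)‖))
      exact this
    rw [Filter.eventually_comap] at h1
    obtain ⟨A₀, hA₀⟩ := Filter.eventually_atTop.mp h1
    refine ⟨A₀, fun σ hσ => ?_⟩
    have h2 := hA₀ σ.im hσ σ rfl
    rw [norm_mul, Complex.norm_exp] at h2
    have hre : (-(π * I * σ / 4)).re = π * σ.im / 4 := by
      rw [neg_re, show (π : ℂ) * I * σ / 4 = ((π / 4 : ℝ) : ℂ) * (I * σ) by push_cast; ring,
        Complex.re_ofReal_mul, Complex.I_mul_re]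
      ring
    rw [hre] at h2
    have hpos : 0 < Real.exp (π * σ.im / 4) := Real.exp_pos _
    rw [show -π * σ.im / 4 = -(π * σ.im / 4) by ring, Real.exp_neg, inv_le_iff_one_le_mul₀ hpos,
      mul_comm]
    exact h2.le
  have hG₃bd : ∀ z : ℍ, max 1 A₀ ≤ z.im →
      ‖G₃ z‖ ≤ Real.exp (π * ((n : ℝ) / 4)) * C₀ + 1 := fun z hz => by
    have hz1 : 1 ≤ (z : ℂ).im := le_trans (le_max_left _ _) hz
    have hzA : A₀ ≤ (z : ℂ).im := le_trans (le_max_right _ _) hz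
    have hzpos : 0 < (z : ℂ).im := z.im_pos
    have hnum := hθwbd z hz1
    have hden : Real.exp (-π * (z : ℂ).im / 4) ^ n ≤ ‖ϑw z‖ := by
      rw [hϑw_eq _ hzpos, norm_pow]
      exact pow_le_pow_left₀ (Real.exp_pos _).le (hA₀ _ hzA) n
    have hdenpos : 0 < Real.exp (-π * (z : ℂ).im / 4) ^ n := pow_pos (Real.exp_pos _) n
    calc ‖G₃ z‖ = ‖θw z / ϑw z - 1‖ := rfl
      _ ≤ ‖θw z / ϑw z‖ + ‖(1 : ℂ)‖ := norm_sub_le _ _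
      _ = ‖θw z‖ / ‖ϑw z‖ + 1 := by rw [norm_div, norm_one]
      _ ≤ Real.exp (-π * ((z : ℂ).im - 1) * ((n : ℝ) / 4)) * C₀ /
            Real.exp (-π * (z : ℂ).im / 4) ^ n + 1 := by
          gcongr ?_ + 1
          exact div_le_div₀ (by positivity) hnum hdenpos hden
      _ = Real.exp (π * ((n : ℝ) / 4)) * C₀ + 1 := by
          congr 1
          rw [← Real.exp_nat_mul, div_eq_iff (Real.exp_pos _).ne']
          have hexp : Real.exp (-π * ((z : ℂ).im - 1) * ((n : ℝ) / 4)) =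
              Real.exp (π * ((n : ℝ) / 4)) * Real.exp ((n : ℝ) * (-π * (z : ℂ).im / 4)) := by
            rw [← Real.exp_add]
            congr 1
            ring
          rw [hexp]
          ring
  -- boundedness and the limit `P → 0`
  obtain ⟨A₁, hA₁⟩ : ∃ A₁ : ℝ, ∀ z : ℍ, A₁ ≤ z.im → ‖G₂ z‖ ≤ 1 := by
    have h := (tendsto_norm.comp hG₂lim).eventually (Iic_mem_nhds (by norm_num : ‖(0 : ℂ)‖ < 1))
    rw [Filter.Eventually, atImInfty_mem] at h
    exact h
  have hPbd : ∀ z : ℍ, max (max 1 A₀) A₁ ≤ z.im →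
      ‖P z‖ ≤ ‖G₁ z‖ * (Real.exp (π * ((n : ℝ) / 4)) * C₀ + 1) := fun z hz => by
    have h3 := hG₃bd z (le_trans (le_max_left _ _) hz)
    have h2 := hA₁ z (le_trans (le_max_right _ _) hz)
    calc ‖P z‖ = ‖G₁ z‖ * ‖G₂ z‖ * ‖G₃ z‖ := by simp only [hP, hPc, norm_mul]
      _ ≤ ‖G₁ z‖ * 1 * (Real.exp (π * ((n : ℝ) / 4)) * C₀ + 1) := by gcongr
      _ = ‖G₁ z‖ * (Real.exp (π * ((n : ℝ) / 4)) * C₀ + 1) := by rw [mul_one]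
  have hPlim : Tendsto P atImInfty (𝓝 0) := by
    have hev : ∀ᶠ z : ℍ in atImInfty,
        ‖P z‖ ≤ ‖G₁ z‖ * (Real.exp (π * ((n : ℝ) / 4)) * C₀ + 1) := by
      rw [Filter.Eventually, atImInfty_mem]
      exact ⟨_, hPbd⟩
    have ha : Tendsto (fun z : ℍ => ‖G₁ z‖ * (Real.exp (π * ((n : ℝ) / 4)) * C₀ + 1)) atImInfty
        (𝓝 0) := by
      have := (tendsto_norm.comp hG₁lim).mul_const (Real.exp (π * ((n : ℝ) / 4)) * C₀ + 1)
      rwa [norm_zero, zero_mul] at this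
    exact squeeze_zero_norm' hev ha
  -- ### `P` is a modular form of weight `0` and level `1` tending to `0` at `i∞`, hence `0`
  have hP0 : ∀ σ : ℂ, σ ∈ U → Pc σ = 0 := fun σ hσ =>
    eq_zero_of_slash_invariant_of_tendsto_zero hS hT hPmd hPlim ⟨σ, hσ⟩
  -- ### one factor vanishes identically; each case forces `f = 1`
  have hcases : Set.EqOn G₁ 0 U ∨ Set.EqOn G₂ 0 U ∨ Set.EqOn G₃ 0 U := by
    rcases eqOn_zero_or_eqOn_zero_of_mul hUo hUc (hG₁d.mul hG₂d) hG₃d hP0 with h12 | h3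
    · rcases eqOn_zero_or_eqOn_zero_of_mul hUo hUc hG₁d hG₂d h12 with h1 | h2
      · exact Or.inl h1
      · exact Or.inr (Or.inl h2)
    · exact Or.inr (Or.inr h3)
  have hf1 : ∀ σ : ℂ, 0 < σ.im → f σ = 1 := by
    intro σ hσ
    rcases hcases with h | h | h
    · have := h hσ
      simp only [hG₁, Pi.zero_apply] at this
      exact sub_eq_zero.mp this
    · have hσ' : 0 < (σ - 1).im := by rw [sub_im, one_im, sub_zero]; exact hσ
      have := h hσ'
      simp only [hG₂, Pi.zero_apply, sub_add_cancel] at this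
      exact sub_eq_zero.mp this
    · -- `σ = 1 - 1/ρ` with `ρ = -1/(σ - 1)`
      have hσ' : 0 < (σ - 1).im := by rw [sub_im, one_im, sub_zero]; exact hσ
      have hρ : 0 < (-(σ - 1)⁻¹).im := neg_inv_im_pos hσ'
      have := h hρ
      rw [Pi.zero_apply, hG₃' _ hρ, inv_neg, inv_inv] at this
      simp only [sub_neg_eq_add, add_sub_cancel] at this
      exact sub_eq_zero.mp this
  -- ### conclusion
  have hmain := hf1 τ hτ
  simp only [hf] at hmain
  rw [div_eq_one_iff_eq (hϑ0 τ hτ)] at hmain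
  exact hmain

/-- **Elkies' theorem, analytic form: `Θ_Γ = θ₃ⁿ`.** Under the hypotheses of
`tsum_cexp_eq_tsum_cexp_span_basisFun` (integral self-dual `Γ ⊂ V`, `dim V = n`, with a
characteristic vector all of whose translates by `2Γ` have square length `≥ n`),
`∑_{x ∈ Γ} e^{πiτ‖x‖²} = θ₃(τ)ⁿ` (Elkies 1995, Theorem: then `Γ ≅ ℤⁿ`; Conway–Sloane Ch. 4 §5:
`Θ_{ℤⁿ} = θ₃ⁿ`). [cite: Elkies1995, Theorem and proof] -/
theorem tsum_cexp_eq_theta3_pow (hint : ∀ x : Γ, ∃ k : ℤ, ‖(x : V)‖ ^ 2 = k)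
    (hdual : dualLattice Γ = Γ) {w : V}
    (hchar : ∀ x : Γ, ∃ k : ℤ, ⟪w, (x : V)⟫ - ‖(x : V)‖ ^ 2 = 2 * k)
    (hmin : ∀ x : Γ, (finrank ℝ V : ℝ) ≤ ‖(2 : ℝ) • (x : V) + w‖ ^ 2) {τ : ℂ} (hτ : 0 < τ.im) :
    ∑' x : Γ, cexp ((π : ℂ) * I * τ * ((‖(x : V)‖ ^ 2 : ℝ) : ℂ)) =
      Literature.NumberTheory.EllipticCurves.JacobiThetaNull.theta3 τ ^ finrank ℝ V := by
  rw [tsum_cexp_eq_tsum_cexp_span_basisFun Γ hint hdual hchar hmin hτ,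
    tsum_cexp_span_basisFun_eq_theta3_pow _ hτ]

end Main

end Literature.Algebra.EuclideanLattices

end
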